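import Literature.Computability.AlgebraicComplexity.KempfOptimalParabolicSL
import Literature.Computability.AlgebraicComplexity.MS2001Thm46OfKempfParabolic
import HarnessLib

/-!
# Mulmuley–Sohoni 2001, Thms. 4.6 and 4.7 over every algebraically closed field: `det_m` and
# `per_n` have closed `SL`-orbits (discharge of `MS2001_thm_4_6`, `MS2001_thm_4_7` by Kempf's
# criterion)

This closer of programme #9 (cell `val-lit`) puts together

* Kempf's theorem for `SL_σ` acting on forms over an algebraically closed field of any
  characteristic — `KempfOptimalParabolicSL.exists_submodule_stable_of_not_isPolystable_of_bruhat`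
  (Kempf 1978, Cor. 4.4: the stabiliser of a point with non-closed orbit preserves a step of the
  canonical destabilising flag), whose Bruhat input is discharged here
  (`exists_sl_bruhat_flagTransport`) from `LinearAlgebra/Matrix/BruhatTwoWeights.lean`
  (Horn–Johnson's LPU factorisation sorted along two weight vectors) and
  `LinearAlgebra/Matrix/WeightFlagSubmodule.lean` (signed permutation matrices transport weight
  flags) — giving the hypothesis-free `exists_submodule_stable_of_not_isPolystable`;
* the glue `MS2001Thm46OfKempfParabolic.lean` (Mulmuley–Sohoni's irreducibility of the stabilisers
  of `det_m` and `per_n` on `m × m` matrices, `MS2001_detStabilizer_irreducible` /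
  `MS2001_perStabilizer_irreducible`, turned into "Kempf's target ⇒ polystable"),

to prove `MS2001_thm_4_6_holds : MS2001_thm_4_6` and `MS2001_thm_4_7_holds : MS2001_thm_4_7` — GCT I
(Mulmuley–Sohoni, SIAM J. Comput. 2001) Thms. 4.6/4.7 of the authors' version (journal 4.1/4.2):
for EVERY algebraically closed field `F` and every `m`, `n`, the forms `det_m` and `per_n` are
stable in MS's sense, i.e. their `SL`-orbits are Zariski closed (`IsPolystable`). The typed facts
live in `MS2001ClassVarieties.lean`, which this file cannot be appended to without an import cycle
(the glue imports it); hence the `_holds` theorems are here, in the same namespace.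

THEOREMS ONLY (no definitions, no named facts; net debt −2). Honest framing: this is the classical
Kempf/Mumford route written out in Lean; it says nothing about `VP` versus `VNP`. Programme #9
bricks: B0 `HilbertMumfordSLForms` · A `KempfTorusWeights` · B `KempfNumericalFunction` ·
C `Analysis/Convex/MaxMinLinearOnSphere` (p5 g6) and `KempfSuperadditiveMaxOnSphere` · D
`BruhatTwoWeights` (p5 g6) · flags `WeightFlagSubmodule` (p5 g6) · E `KempfOptimalParabolicSL` ·
glue `MS2001Thm46OfKempfParabolic` (p5 g6) · this file.

## References

* [MulmuleySohoniSIAM2001] K. Mulmuley, M. Sohoni, *Geometric complexity theory I*, SIAM J.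
  Comput. 31 (2001), Thms. 4.6, 4.7 of the authors' version (AV p.15) = journal Thms. 4.1, 4.2.
* [Kempf1978] G. R. Kempf, *Instability in invariant theory*, Ann. of Math. (2) 108 (1978), Cor. 4.4.
* [HornJohnson2013] R. A. Horn, C. R. Johnson, *Matrix Analysis*, 2nd ed., Thm. 3.5.11.
-/

noncomputable section

open scoped BigOperators
open MvPolynomial

namespace Literature.Computability.AlgebraicComplexity

/-! ## Discharging the Bruhat input and the Mulmuley–Sohoni facts -/

section Closer

open Literature.LinearAlgebra.Matrix

variable {K : Type} [Field K] {σ : Type} [Fintype σ] [DecidableEq σ]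

/-- For `x ∈ SL`, the coerced group inverse is the matrix inverse. [folklore] -/
private theorem coe_inv_eq_inv (x : Matrix.SpecialLinearGroup σ K) :
    ((x⁻¹ : Matrix.SpecialLinearGroup σ K) : Matrix σ σ K) = (x : Matrix σ σ K)⁻¹ := by
  rw [Matrix.SpecialLinearGroup.coe_inv, Matrix.inv_def, x.det_coe, Ring.inverse_one, one_smul]

/-- A monomial matrix over `π` with non-zero determinant has `w_{π z, z} ≠ 0`.
[cite: Kempf1978, §2 (the Weyl group)] -/
private theorem apply_perm_ne_zero_of_monomial' {w : Matrix σ σ K} {π : Equiv.Perm σ}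
    (hw : ∀ i j, w i j ≠ 0 → i = π j) (hdet : w.det ≠ 0) (z : σ) : w (π z) z ≠ 0 := by
  intro hz
  apply hdet
  refine Matrix.det_eq_zero_of_column_eq_zero z fun x => ?_
  by_cases hx : x = π z
  · rw [hx]; exact hz
  · by_contra hne
    exact hx (hw x z hne)

/-- The inverse of an invertible monomial matrix over `π` is monomial over `π⁻¹`.
[cite: Kempf1978, §2 (the Weyl group)] -/
private theorem inv_apply_ne_zero_of_monomial' {w : Matrix σ σ K} {π : Equiv.Perm σ}
    (hw : ∀ i j, w i j ≠ 0 → i = π j) (hdet : w.det ≠ 0) {i j : σ} (h : w⁻¹ i j ≠ 0) :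
    i = π.symm j := by
  have hcol := apply_perm_ne_zero_of_monomial' hw hdet
  have hinv : w⁻¹ * w = 1 := Matrix.nonsing_inv_mul w (isUnit_iff_ne_zero.mpr hdet)
  set z := π.symm j with hz
  have hjz : j = π z := by rw [hz, Equiv.apply_symm_apply]
  by_contra hiz
  have h1 : (w⁻¹ * w) i z = 0 := by rw [hinv, Matrix.one_apply_ne hiz]
  rw [Matrix.mul_apply, Finset.sum_eq_single (π z)] at h1
  · rw [← hjz] at h1
    exact (mul_ne_zero h (hjz ▸ hcol z)) h1
  · intro y _ hy
    by_cases hwy : w y z = 0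
    · rw [hwy, mul_zero]
    · exact absurd (hw y z hwy) hy
  · intro h0
    exact absurd (Finset.mem_univ _) h0

/-- **The Bruhat input of `exists_submodule_stable_of_not_isPolystable_of_bruhat`**, from
`BruhatTwoWeights.exists_parabolic_mul_signedPerm_mul_parabolic` (Horn–Johnson LPU) and
`WeightFlagSubmodule.weightFlag_signedPerm_mul`: `g = p₂ · ŵ · p₁` in `SL_σ(K)` with `p_i^{±1} ∈ P_{a_i}`,
`ŵ` a signed permutation matrix transporting weight flags.
[cite: Kempf1978, §2 (proof of Thm. 2.2)] [cite: HornJohnson2013, Thm 3.5.11] -/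
theorem exists_sl_bruhat_flagTransport (a₁ a₂ : σ → ℝ) (g : Matrix.SpecialLinearGroup σ K) :
    ∃ (p₂ w p₁ : Matrix.SpecialLinearGroup σ K) (π : Equiv.Perm σ),
      (p₂ : Matrix σ σ K).BlockTriangular (OrderDual.toDual ∘ a₂) ∧
      ((p₂⁻¹ : Matrix.SpecialLinearGroup σ K) : Matrix σ σ K).BlockTriangular
        (OrderDual.toDual ∘ a₂) ∧
      (p₁ : Matrix σ σ K).BlockTriangular (OrderDual.toDual ∘ a₁) ∧
      ((p₁⁻¹ : Matrix.SpecialLinearGroup σ K) : Matrix σ σ K).BlockTriangular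
        (OrderDual.toDual ∘ a₁) ∧
      (∀ i j, (w : Matrix σ σ K) i j ≠ 0 → i = π.symm j) ∧
      (∀ i j, ((w⁻¹ : Matrix.SpecialLinearGroup σ K) : Matrix σ σ K) i j ≠ 0 → i = π j) ∧
      (∀ (h : Matrix σ σ K) (a : σ → ℝ) (r : ℝ),
        (Submodule.pi {i : σ | a i < r} (fun _ => (⊥ : Submodule K K))).comap
            ((w : Matrix σ σ K) * h).mulVecLin =
          (Submodule.pi {i : σ | (a ∘ π.symm) i < r} (fun _ => (⊥ : Submodule K K))).comap
            h.mulVecLin) ∧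
      g = p₂ * w * p₁ := by
  classical
  obtain ⟨p₂, p₁, π, ε, hp₂, hp₁, hdet₂, hdet₁, hε, hdetw, hg⟩ :=
    exists_parabolic_mul_signedPerm_mul_parabolic (g : Matrix σ σ K) g.det_coe a₁ a₂
  have hε0 : ∀ j, ε j ≠ 0 := fun j => by
    rcases hε j with h | h <;> rw [h] <;> norm_num
  set P₂ : Matrix.SpecialLinearGroup σ K := ⟨p₂, hdet₂⟩ with hP₂
  set P₁ : Matrix.SpecialLinearGroup σ K := ⟨p₁, hdet₁⟩ with hP₁
  set W : Matrix.SpecialLinearGroup σ K := ⟨π.toPEquiv.toMatrix * Matrix.diagonal ε, hdetw⟩ with hW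
  have hWm : ∀ i j, (W : Matrix σ σ K) i j ≠ 0 → i = π.symm j := by
    intro i j h
    change (π.toPEquiv.toMatrix * Matrix.diagonal ε : Matrix σ σ K) i j ≠ 0 at h
    rw [signedPerm_apply] at h
    by_cases hj : j = π i
    · rw [hj, Equiv.symm_apply_apply]
    · exact absurd (if_neg hj) h
  refine ⟨P₂, W, P₁, π, hp₂, ?_, hp₁, ?_, hWm, ?_, fun h a r => weightFlag_signedPerm_mul π hε0 h a r,
    Subtype.ext ?_⟩
  · rw [coe_inv_eq_inv]
    haveI : Invertible (P₂ : Matrix σ σ K) :=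
      Matrix.invertibleOfIsUnitDet _ (by rw [P₂.det_coe]; exact isUnit_one)
    exact Matrix.blockTriangular_inv_of_blockTriangular hp₂
  · rw [coe_inv_eq_inv]
    haveI : Invertible (P₁ : Matrix σ σ K) :=
      Matrix.invertibleOfIsUnitDet _ (by rw [P₁.det_coe]; exact isUnit_one)
    exact Matrix.blockTriangular_inv_of_blockTriangular hp₁
  · intro i j h
    rw [coe_inv_eq_inv] at h
    have := inv_apply_ne_zero_of_monomial' hWm (by rw [W.det_coe]; exact one_ne_zero) h
    rwa [Equiv.symm_symm] at this
  · rw [Matrix.SpecialLinearGroup.coe_mul, Matrix.SpecialLinearGroup.coe_mul]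
    exact hg

/-- **Kempf's theorem (1978, Cor. 4.4) for `SL_σ` acting on forms, over any algebraically closed
field**: a form `v` whose `SL`-orbit is not Zariski closed has a non-zero proper subspace of `K^σ`
(a step of its canonical destabilising flag) mapped into itself by every element of `SL_σ(K)`
fixing `v` — the stabiliser lies in a proper parabolic subgroup. [cite: Kempf1978, Cor. 4.4] -/
theorem exists_submodule_stable_of_not_isPolystable [IsAlgClosed K] {v : MvPolynomial σ K} {D : ℕ}
    (hv : v.IsHomogeneous D) (hnp : ¬ IsPolystable v) :
    ∃ W : Submodule K (σ → K), W ≠ ⊥ ∧ W ≠ ⊤ ∧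
      ∀ γ : Matrix.SpecialLinearGroup σ K, linSubst σ K (γ : Matrix σ σ K) v = v →
        ∀ x ∈ W, (γ : Matrix σ σ K).mulVec x ∈ W :=
  exists_submodule_stable_of_not_isPolystable_of_bruhat hv hnp
    fun a₁ a₂ g => exists_sl_bruhat_flagTransport a₁ a₂ g

/-- **Mulmuley–Sohoni 2001, Thm. 4.6, over every algebraically closed field** (discharge of the
typed fact `MS2001_thm_4_6`): `det_m` has a closed `SL_{m²}`-orbit. Kempf's criterion
(`exists_submodule_stable_of_not_isPolystable`) + the irreducibility of the stabiliser of `det_m` on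
`m × m` matrices (`MS2001_detStabilizer_irreducible`, via `MS2001_thm_4_6_of_parabolic`).
[cite: MulmuleySohoniSIAM2001, Thm. 4.6 of the authors' version = journal Thm. 4.1 (AV p.15)]
[cite: Kempf1978, Cor. 4.4] -/
theorem MS2001_thm_4_6_holds : MS2001_thm_4_6 :=
  MS2001_thm_4_6_of_parabolic fun K _ _ N _ _ hv hnp =>
    exists_submodule_stable_of_not_isPolystable (K := K) (σ := Fin N × Fin N) hv hnp

/-- **Mulmuley–Sohoni 2001, Thm. 4.7, over every algebraically closed field** (discharge of the
typed fact `MS2001_thm_4_7`): `per_n` has a closed `SL_{n²}`-orbit (Kempf's criterion + the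
irreducibility of the stabiliser of `per_n`, `MS2001_perStabilizer_irreducible`, via
`MS2001_thm_4_7_of_parabolic`).
[cite: MulmuleySohoniSIAM2001, Thm. 4.7 of the authors' version = journal Thm. 4.2 (AV p.15)]
[cite: Kempf1978, Cor. 4.4] -/
theorem MS2001_thm_4_7_holds : MS2001_thm_4_7 :=
  MS2001_thm_4_7_of_parabolic fun K _ _ N _ _ hv hnp =>
    exists_submodule_stable_of_not_isPolystable (K := K) (σ := Fin N × Fin N) hv hnp

/-- **Kempf's criterion (1978, Cor. 4.5) for `SL_σ` on forms, consumable form**: if NO non-zero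
proper subspace of `K^σ` is mapped into itself by every `γ ∈ SL_σ(K)` fixing the form `v` (i.e.
`Stab_SL(v)` acts irreducibly on `K^σ`, so lies in no proper parabolic subgroup), then the
`SL`-orbit of `v` is Zariski closed. [cite: Kempf1978, Cor. 4.5] -/
theorem isPolystable_of_forall_submodule_sl [IsAlgClosed K] {v : MvPolynomial σ K} {D : ℕ}
    (hv : v.IsHomogeneous D)
    (hirr : ∀ W : Submodule K (σ → K),
      (∀ γ : Matrix.SpecialLinearGroup σ K, linSubst σ K (γ : Matrix σ σ K) v = v →
        ∀ x ∈ W, (γ : Matrix σ σ K).mulVec x ∈ W) → W = ⊥ ∨ W = ⊤) :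
    IsPolystable v := by
  by_contra hnp
  obtain ⟨W, hbot, htop, hW⟩ := exists_submodule_stable_of_not_isPolystable hv hnp
  rcases hirr W hW with h | h
  · exact hbot h
  · exact htop h

/-- **Kempf's criterion, `GL`-subgroup phrasing** (the hypothesis shape of
`MS2001_detStabilizer_irreducible` / `MS2001_perStabilizer_irreducible`: irreducibility of `K^σ`
under `slSubgroup σ K ⊓ linStabilizer v`): such a form `v` has a closed `SL`-orbit.
[cite: Kempf1978, Cor. 4.5] [cite: MulmuleySohoniSIAM2001, §3 (Kempf's criterion), proofs of Thms. 4.6, 4.7, 7.3] -/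
theorem isPolystable_of_forall_submodule [IsAlgClosed K] {v : MvPolynomial σ K} {D : ℕ}
    (hv : v.IsHomogeneous D)
    (hirr : ∀ W : Submodule K (σ → K),
      (∀ γ ∈ slSubgroup σ K ⊓ linStabilizer v, ∀ w ∈ W, (γ : Matrix σ σ K).mulVec w ∈ W) →
        W = ⊥ ∨ W = ⊤) :
    IsPolystable v := by
  refine isPolystable_of_forall_submodule_sl hv fun W hW => hirr W ?_
  intro γ hγ w hw
  obtain ⟨hsl, hstab⟩ := Subgroup.mem_inf.mp hγ
  rw [mem_slSubgroup_iff] at hsl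
  rw [mem_linStabilizer, linSubstRep_apply] at hstab
  exact hW ⟨(γ : Matrix σ σ K), hsl⟩ hstab w hw

end Closer

end Literature.Computability.AlgebraicComplexity
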